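import Literature.Analysis.FunctionSpaces.SchwartzComplete
import Literature.Analysis.FunctionSpaces.MultilinearBanachSteinhaus

/-!
# Banach–Steinhaus for multilinear families on closed subspaces of the Schwartz space

Topic `Literature/Analysis/FunctionSpaces`; the instantiation of `MultilinearBanachSteinhaus.lean` needed by continuum-limit
arguments in which the `n` test functions of an `n`-point functional range over CLOSED SUBSPACES of `𝓢(E, V)` (e.g. the
functions supported in fixed pairwise disjoint compact sets, on which lattice `n`-point functionals converge):

* `baireSpace_of_isClosed_submodule_schwartz` — a closed subspace of `𝓢` is Baire (`SchwartzComplete`);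
* `withSeminorms_submodule_schwartz` — the restricted Schwartz seminorms generate the subspace topology;
* `tendsto_apply_of_pointwise_tendsto_schwartzSubmodule` — a pointwise convergent SEQUENCE of continuous multilinear maps
  `T k : ∏ᵢ Sᵢ → G` converges along convergent sequences of arguments: `T k (x k) → T∞ x₀`.

Mathlib + the two companions; no definitions. [folklore]
-/

noncomputable section

open Filter Topology Set Function SchwartzMap Uniformity
open scoped SchwartzMap

namespace Literature.Analysis.FunctionSpaces


variable {E : Type*} [NormedAddCommGroup E] [NormedSpace ℝ E]
variable {V : Type*} [NormedAddCommGroup V] [NormedSpace ℝ V] [CompleteSpace V]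

/-- A closed subspace of the Schwartz space is a Baire space (complete, with countably generated uniformity).
[folklore] -/
theorem baireSpace_of_isClosed_submodule_schwartz (S : Submodule ℝ 𝓢(E, V)) (hS : IsClosed (S : Set 𝓢(E, V))) :
    BaireSpace S := by
  have : CompleteSpace 𝓢(E, V) := completeSpace_schwartzMap
  have : (𝓤 𝓢(E, V)).IsCountablyGenerated := IsUniformAddGroup.uniformity_countably_generated
  haveI : CompleteSpace S := hS.completeSpace_coe
  have : (𝓤 S).IsCountablyGenerated := by
    rw [uniformity_subtype]
    infer_instance
  infer_instance

omit [CompleteSpace V] in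
/-- The Schwartz seminorms restricted to a subspace generate its (subspace) topology. [folklore] -/
theorem withSeminorms_submodule_schwartz (S : Submodule ℝ 𝓢(E, V)) :
    WithSeminorms ((schwartzSeminormFamily ℝ E V).comp S.subtype) :=
  (Topology.IsInducing.subtypeVal).withSeminorms (schwartz_withSeminorms ℝ E V) (f := S.subtype)


/-- **Pointwise convergent sequences of continuous multilinear functionals on closed subspaces of the Schwartz space
converge along convergent arguments** (`MultilinearMap.tendsto_apply_of_pointwise_tendsto` on the Baire spaces `Sᵢ`
with the restricted Schwartz seminorms). [folklore] -/
theorem tendsto_apply_of_pointwise_tendsto_schwartzSubmodule {G : Type*} [SeminormedAddCommGroup G] [NormedSpace ℝ G]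
    {n : ℕ} (S : Fin n → Submodule ℝ 𝓢(E, V)) (hS : ∀ i, IsClosed (S i : Set 𝓢(E, V)))
    (T : ℕ → MultilinearMap ℝ (fun i => ↥(S i)) G) (hT : ∀ k, Continuous (T k)) (Tlim : (∀ i, ↥(S i)) → G)
    (hconv : ∀ x, Tendsto (fun k => T k x) atTop (𝓝 (Tlim x))) {x : ℕ → ∀ i, ↥(S i)} {x₀ : ∀ i, ↥(S i)}
    (hx : Tendsto x atTop (𝓝 x₀)) : Tendsto (fun k => T k (x k)) atTop (𝓝 (Tlim x₀)) := by
  haveI : ∀ i, BaireSpace ↥(S i) := fun i => baireSpace_of_isClosed_submodule_schwartz (S i) (hS i)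
  exact MultilinearMap.tendsto_apply_of_pointwise_tendsto G
    (fun i => (schwartzSeminormFamily ℝ E V).comp (S i).subtype) (fun i => withSeminorms_submodule_schwartz (S i))
    T hT Tlim hconv hx

end Literature.Analysis.FunctionSpaces

end
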